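import Summits.Ventures.PercRepro.C041TriDomTwoExitPiece

/-!
# ROW C-041 — THE TWO-EXIT MARKLESS PIECE, II: THE EXITS OF DIFFERENT COLOURS, AND THE IGNORED COLOURS
(p6, gen 46; P6-TWOEXIT-LEAN.md §53 ADDENDUM 17)

The second half of THE FIBRE IDENTITY of `C041TriDomTwoExitPiece`: when the two exits `f₁, f₂` of a two-exit markless
piece `K` have DIFFERENT colours, the red and blue connectivities of `st` between vertices off `K` are those of
`stDel st f₁ f₂` (both exits deleted) — `RdS_stDel_iff`, `MgS_stDel_iff`: the red exit is the only red edge between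
`K` and its complement (`redE_st_iff_stDel_or`), the blue exit the only blue one, and THE REACH LEMMA
(`reach_iff_of_col_or_exit`) removes each.  Then the two facts the fibre count needs about the derived statuses: the
connectivities of `stCon` ignore the colour of the contracted exit (`RdS_stCon_congr`, `MgS_stCon_congr`) and those of
`stDel` the colours of both exits (`RdS_stDel_congr`, `MgS_stDel_congr`) — a non-free edge's colour is never read
(`RdS_congr_free`).
-/

namespace PercRepro

namespace ZoneZ

namespace MultiExit

open ZoneData Finset

variable {V₁ E₁ U₁ U₂ : Type} (Z₁ : ZoneData V₁ E₁ U₁ U₂) [DecidableEq E₁]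

variable {st : E₁ → EStat} {K : Set V₁} {u v : V₁} {f₁ f₂ : E₁}

/-! ## The exits of different colours: `st` and `stDel` agree off `K` -/

/-- A red edge of `st` whose colour is not that of the (free) edge `g` is red under `stDel` or is the other exit. -/
theorem redE_st_iff_stDel_or (hT : TwoExit Z₁ st K u v f₁ f₂) (ω : E₁ → Bool) (hf₁ : ω f₁ = true)
    (hf₂ : ω f₂ = false) (e : E₁) : redE st ω e ↔ redE (stDel st f₁ f₂) ω e ∨ e = f₁ := by
  rw [redE_stDel]
  constructor
  · intro h
    by_cases h1 : e = f₁
    · exact Or.inr h1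
    · by_cases h2 : e = f₂
      · rw [h2, redE_free_iff hT.hs₂, hf₂] at h
        exact absurd h (by decide)
      · exact Or.inl ⟨h, fun h' => h'.elim h1 h2⟩
  · rintro (⟨h, _⟩ | h)
    · exact h
    · rw [h, redE_free_iff hT.hs₁]
      exact hf₁

/-- The symmetric statement for the second exit. -/
theorem redE_st_iff_stDel_or' (hT : TwoExit Z₁ st K u v f₁ f₂) (ω : E₁ → Bool) (hf₁ : ω f₁ = false)
    (hf₂ : ω f₂ = true) (e : E₁) : redE st ω e ↔ redE (stDel st f₁ f₂) ω e ∨ e = f₂ := by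
  rw [redE_stDel]
  constructor
  · intro h
    by_cases h2 : e = f₂
    · exact Or.inr h2
    · by_cases h1 : e = f₁
      · rw [h1, redE_free_iff hT.hs₁, hf₁] at h
        exact absurd h (by decide)
      · exact Or.inl ⟨h, fun h' => h'.elim h1 h2⟩
  · rintro (⟨h, _⟩ | h)
    · exact h
    · rw [h, redE_free_iff hT.hs₂]
      exact hf₂

/-- A blue edge of `st` is blue under `stDel` or is the blue exit. -/
theorem blueE_st_iff_stDel_or (hT : TwoExit Z₁ st K u v f₁ f₂) (ω : E₁ → Bool) (hf₁ : ω f₁ = true)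
    (hf₂ : ω f₂ = false) (e : E₁) : blueE st ω e ↔ blueE (stDel st f₁ f₂) ω e ∨ e = f₂ := by
  rw [blueE_stDel]
  constructor
  · intro h
    by_cases h2 : e = f₂
    · exact Or.inr h2
    · by_cases h1 : e = f₁
      · rw [h1, blueE_free_iff hT.hs₁, hf₁] at h
        exact absurd h (by decide)
      · exact Or.inl ⟨h, fun h' => h'.elim h1 h2⟩
  · rintro (⟨h, _⟩ | h)
    · exact h
    · rw [h, blueE_free_iff hT.hs₂]
      exact hf₂

/-- The symmetric statement for the first exit. -/
theorem blueE_st_iff_stDel_or' (hT : TwoExit Z₁ st K u v f₁ f₂) (ω : E₁ → Bool) (hf₁ : ω f₁ = false)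
    (hf₂ : ω f₂ = true) (e : E₁) : blueE st ω e ↔ blueE (stDel st f₁ f₂) ω e ∨ e = f₁ := by
  rw [blueE_stDel]
  constructor
  · intro h
    by_cases h1 : e = f₁
    · exact Or.inr h1
    · by_cases h2 : e = f₂
      · rw [h2, blueE_free_iff hT.hs₂, hf₂] at h
        exact absurd h (by decide)
      · exact Or.inl ⟨h, fun h' => h'.elim h1 h2⟩
  · rintro (⟨h, _⟩ | h)
    · exact h
    · rw [h, blueE_free_iff hT.hs₁]
      exact hf₁

/-- No exit edge is red under `stDel`. -/
theorem not_redE_stDel_exit (ω : E₁ → Bool) {e : E₁} (he : e = f₁ ∨ e = f₂) : ¬ redE (stDel st f₁ f₂) ω e := by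
  rw [redE_stDel]
  exact fun h => h.2 he

/-- No exit edge is blue under `stDel`. -/
theorem not_blueE_stDel_exit (ω : E₁ → Bool) {e : E₁} (he : e = f₁ ∨ e = f₂) : ¬ blueE (stDel st f₁ f₂) ω e := by
  rw [blueE_stDel]
  exact fun h => h.2 he

/-- A red edge of `stDel` is present under `st`. -/
theorem presE_of_redE_stDel {ω : E₁ → Bool} {e : E₁} (h : redE (stDel st f₁ f₂) ω e) : presE st e :=
  redE_pres ((redE_stDel ω e).mp h).1

/-- A blue edge of `stDel` is present under `st`. -/
theorem presE_of_blueE_stDel {ω : E₁ → Bool} {e : E₁} (h : blueE (stDel st f₁ f₂) ω e) : presE st e :=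
  blueE_pres ((blueE_stDel ω e).mp h).1

/-- **The exits of different colours**: off `K`, the red connectivity of `st` is that of `stDel`. -/
theorem RdS_stDel_iff (hT : TwoExit Z₁ st K u v f₁ f₂) (ω : E₁ → Bool) (h : ω f₁ ≠ ω f₂) {a b : V₁}
    (ha : a ∉ K) (hb : b ∉ K) : RdS Z₁ (stDel st f₁ f₂) ω a b ↔ RdS Z₁ st ω a b := by
  unfold RdS
  rw [RAdjS_eq_AdjCol, RAdjS_eq_AdjCol]
  rcases Bool.eq_false_or_eq_true (ω f₁) with h₁ | h₁
  · have h₂ : ω f₂ = false := by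
      rcases Bool.eq_false_or_eq_true (ω f₂) with h₂ | h₂
      · exact absurd (h₁.trans h₂.symm) h
      · exact h₂
    obtain ⟨w, hw, hj⟩ := hT.hj₁
    exact (reach_iff_of_col_or_exit Z₁ hT hw hT.hu hj (fun e he => presE_of_redE_stDel he)
      (not_redE_stDel_exit ω (Or.inl rfl)) (not_redE_stDel_exit ω (Or.inr rfl))
      (redE_st_iff_stDel_or Z₁ hT ω h₁ h₂) ha hb).symm
  · have h₂ : ω f₂ = true := by
      rcases Bool.eq_false_or_eq_true (ω f₂) with h₂ | h₂
      · exact h₂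
      · exact absurd (h₁.trans h₂.symm) h
    obtain ⟨w, hw, hj⟩ := hT.hj₂
    exact (reach_iff_of_col_or_exit Z₁ hT hw hT.hv hj (fun e he => presE_of_redE_stDel he)
      (not_redE_stDel_exit ω (Or.inl rfl)) (not_redE_stDel_exit ω (Or.inr rfl))
      (redE_st_iff_stDel_or' Z₁ hT ω h₁ h₂) ha hb).symm

/-- **The exits of different colours**: off `K`, the blue connectivity of `st` is that of `stDel`. -/
theorem MgS_stDel_iff (hT : TwoExit Z₁ st K u v f₁ f₂) (ω : E₁ → Bool) (h : ω f₁ ≠ ω f₂) {a b : V₁}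
    (ha : a ∉ K) (hb : b ∉ K) : MgS Z₁ (stDel st f₁ f₂) ω a b ↔ MgS Z₁ st ω a b := by
  unfold MgS
  rw [BAdjS_eq_AdjCol, BAdjS_eq_AdjCol]
  rcases Bool.eq_false_or_eq_true (ω f₁) with h₁ | h₁
  · have h₂ : ω f₂ = false := by
      rcases Bool.eq_false_or_eq_true (ω f₂) with h₂ | h₂
      · exact absurd (h₁.trans h₂.symm) h
      · exact h₂
    obtain ⟨w, hw, hj⟩ := hT.hj₂
    exact (reach_iff_of_col_or_exit Z₁ hT hw hT.hv hj (fun e he => presE_of_blueE_stDel he)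
      (not_blueE_stDel_exit ω (Or.inl rfl)) (not_blueE_stDel_exit ω (Or.inr rfl))
      (blueE_st_iff_stDel_or Z₁ hT ω h₁ h₂) ha hb).symm
  · have h₂ : ω f₂ = true := by
      rcases Bool.eq_false_or_eq_true (ω f₂) with h₂ | h₂
      · exact h₂
      · exact absurd (h₁.trans h₂.symm) h
    obtain ⟨w, hw, hj⟩ := hT.hj₁
    exact (reach_iff_of_col_or_exit Z₁ hT hw hT.hu hj (fun e he => presE_of_blueE_stDel he)
      (not_blueE_stDel_exit ω (Or.inl rfl)) (not_blueE_stDel_exit ω (Or.inr rfl))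
      (blueE_st_iff_stDel_or' Z₁ hT ω h₁ h₂) ha hb).symm

/-! ## The connectivities of `stCon` and `stDel` ignore the colours of the exits -/

/-- A free edge of `stCon` is not the contracted exit. -/
theorem ne_of_stCon_free {e : E₁} (h : stCon st f₁ e = EStat.free) : e ≠ f₁ := by
  intro he
  unfold stCon at h
  rw [if_pos he] at h
  exact absurd h (by decide)

/-- A free edge of `stDel` is not an exit. -/
theorem not_exit_of_stDel_free {e : E₁} (h : stDel st f₁ f₂ e = EStat.free) : ¬ (e = f₁ ∨ e = f₂) := by
  intro he
  unfold stDel at h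
  rw [if_pos he] at h
  exact absurd h (by decide)

/-- The red connectivity of `stCon` ignores the colour of the contracted exit. -/
theorem RdS_stCon_congr {ω ω' : E₁ → Bool} (h : ∀ e, e ≠ f₁ → ω e = ω' e) :
    RdS Z₁ (stCon st f₁) ω = RdS Z₁ (stCon st f₁) ω' :=
  RdS_congr_free Z₁ _ fun e he => h e (ne_of_stCon_free he)

/-- The blue connectivity of `stCon` ignores the colour of the contracted exit. -/
theorem MgS_stCon_congr {ω ω' : E₁ → Bool} (h : ∀ e, e ≠ f₁ → ω e = ω' e) :
    MgS Z₁ (stCon st f₁) ω = MgS Z₁ (stCon st f₁) ω' :=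
  MgS_congr_free Z₁ _ fun e he => h e (ne_of_stCon_free he)

/-- The red connectivity of `stDel` ignores the colours of the exits. -/
theorem RdS_stDel_congr {ω ω' : E₁ → Bool} (h : ∀ e, ¬ (e = f₁ ∨ e = f₂) → ω e = ω' e) :
    RdS Z₁ (stDel st f₁ f₂) ω = RdS Z₁ (stDel st f₁ f₂) ω' :=
  RdS_congr_free Z₁ _ fun e he => h e (not_exit_of_stDel_free he)

/-- The blue connectivity of `stDel` ignores the colours of the exits. -/
theorem MgS_stDel_congr {ω ω' : E₁ → Bool} (h : ∀ e, ¬ (e = f₁ ∨ e = f₂) → ω e = ω' e) :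
    MgS Z₁ (stDel st f₁ f₂) ω = MgS Z₁ (stDel st f₁ f₂) ω' :=
  MgS_congr_free Z₁ _ fun e he => h e (not_exit_of_stDel_free he)

end MultiExit

end ZoneZ

end PercRepro
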